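import Mathlib.Analysis.LocallyConvex.Separation
import Mathlib.Analysis.LocallyConvex.WithSeminorms
import Mathlib.Topology.ContinuousMap.Weierstrass
import Mathlib.Topology.MetricSpace.Bounded
import Mathlib.Analysis.Convex.Basic
import Mathlib.Algebra.BigOperators.Pi
import Mathlib.Algebra.BigOperators.Expect
import Mathlib.Algebra.Order.BigOperators.Expect
import Mathlib.Algebra.BigOperators.Ring.Finset
import Literature.Combinatorics.Additive.RelativeSzemerediDenseModel
import HarnessLib

/-!
# The dense model theorem for a family of bounded test functions (Gowers; Reingold–Trevisan–Tulsiani–Vadhan)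

Topic `Literature/Combinatorics/Additive`. This file proves the **dense model theorem** in the
abstract form of W. T. Gowers, *Decompositions, approximate structure, transference, and the
Hahn–Banach theorem*, Bull. Lond. Math. Soc. 42 (2010), 573–606 (Thm. 4.8 / the discussion of
§4, "the Green–Tao–Ziegler transference theorem") and O. Reingold, L. Trevisan, M. Tulsiani,
S. Vadhan, *Dense subsets of pseudorandom sets*, FOCS 2008 (Thm. 1.1 in the "functions" form of
their §3): on a finite probability space `Z` (uniform measure), let `Φ = (φ_a)_{a ∈ A}` be a finite
family of test functions bounded by `1`, and measure functions by the seminorm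
`‖h‖_Φ = sup_a |𝔼 h φ_a|`. **For every `ε > 0` there are `K = K(ε)` and `ε' = ε'(ε) > 0`, depending
on `ε` only (not on `Z`, `A`, `Φ`), such that: if `ν : Z → [0, ∞)` satisfies
`|𝔼 (ν - 1) φ_{a_1} ⋯ φ_{a_m}| ≤ ε'` for all `m ≤ K` and all `a_1, …, a_m ∈ A`, then every
`f : Z → [0, ∞)` with `f ≤ ν` has a dense model `g : Z → [0, 1]` with `‖f - g‖_Φ ≤ ε`**
(`Literature.Combinatorics.Additive.DenseModel.denseModel`), together with the signed variant for
`|f| ≤ ν` (`…denseModel_abs`, models with values in `[-1, 1]`, by splitting `f = f⁺ - f⁻` as in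
Green–Tao 2010, footnote to Prop. 10.3).

The tree already holds the cut-norm instance of this theorem (Conlon–Fox–Zhao, Thm. 5.1, in Zhao's
form: `Literature.Combinatorics.Additive.CFZ.denseModel_holds`, file
`RelativeSzemerediDenseModel.lean`), where the test functions are the generalized convolutions of
cut families and the hypothesis is `‖ν - 1‖_□ ≤ ε'` — there the family is closed under
multiplication (CFZ Lemma 5.2), which is what allows the hypothesis to mention single test
functions only. The present file runs the same proof (Gowers / Reingold–Trevisan–Tulsiani–Vadhan,
via the finite-dimensional Hahn–Banach theorem and the Weierstrass approximation theorem) for an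
ARBITRARY finite family, the price being the hypothesis on products of at most `K` test functions
(exactly the hypothesis of Gowers's and RTTV's formulations). It is the form needed to transfer
the Gowers uniformity norms (test functions = dual functions), cf. Green–Tao 2010, Prop. 10.3 and
Tao–Ziegler 2008, Thm. 7.1; that application lives in
`Literature/NumberTheory/Sieve/LinearEquationsInPrimesKoopmanVonNeumann.lean`.

## The proof

With `ε₀ = min(ε, 1/10)`, `M = 2/ε₀`, a Weierstrass polynomial `P` with `|P(x) - x₊| < ε₀/8` on
`[-M, M]`, `R = ∑ |p_i| M^i`, `K = deg P` and `ε' = ε₀ / (8(R+1))` (all functions of `ε` alone):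
if no `g : Z → [0, 1 + ε₀/2]` has `‖f - g‖_Φ ≤ ε₀/2`, the Hahn–Banach theorem separates `f` from
`[0, 1+ε₀/2]^Z + {‖h‖_Φ ≤ ε₀/2}` by a functional `ψ` with `⟨f, ψ⟩ > 1`, `(1 + ε₀/2) 𝔼 ψ₊ < 1` and
`|⟨h, ψ⟩| ≤ M ‖h‖_Φ` (`exists_separating`, `dual_bound_of_separating`); hence `‖ψ‖_∞ ≤ M`
(`abs_le_of_dual`) and, by a second separation, `ψ / M` lies in the absolutely convex hull
`B = {∑ c_a φ_a : ∑ |c_a| ≤ 1}` of the family (`div_mem_ballGen_of_dual`), so that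
`|⟨ν - 1, ψ^m⟩| ≤ M^m ε'` for `m ≤ K` by expanding the power (`abs_inner_pow_le`). Then
`1 < ⟨f,ψ⟩ ≤ ⟨ν, ψ₊⟩ ≤ ⟨ν, P(ψ)⟩ + (ε₀/8) 𝔼 ν ≤ 𝔼 P(ψ) + ε' R + (ε₀/8)(1 + ε') ≤
𝔼 ψ₊ + ε₀/8 + ε₀/8 + (ε₀/8)(1+ε') < 1`, a contradiction (`exists_predense_model`); capping the
model at `1` costs another `ε₀/2` (`denseModel`).

## References

* W. T. Gowers, *Decompositions, approximate structure, transference, and the Hahn–Banach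
  theorem*, Bull. Lond. Math. Soc. 42 (2010), 573–606, §4. [cite: Gowers2010, §4]
* O. Reingold, L. Trevisan, M. Tulsiani, S. Vadhan, *Dense subsets of pseudorandom sets*,
  49th FOCS (2008), 76–85, Thm. 1.1 / §3. [cite: ReingoldEtAl2008, Thm. 1.1]
* T. Tao, T. Ziegler, *The primes contain arbitrarily long polynomial progressions*, Acta Math.
  201 (2008), 213–305, Thm. 7.1 (dense model theorem w.r.t. dual functions).
* D. Conlon, J. Fox, Y. Zhao, *The Green–Tao theorem: an exposition*, EMS Surv. Math. Sci. 1
  (2014), 249–282, Thm. 5.1 and its proof (the template followed here). [cite: ConlonFoxZhao2014, Theorem 5.1]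
* B. Green, T. Tao, *Linear equations in primes*, Ann. of Math. 171 (2010), Prop. 10.3 and the
  footnote to it (signed functions). [cite: GreenTao2010, Prop. 10.3]
-/

noncomputable section

open Finset
open scoped BigOperators

namespace Literature.Combinatorics.Additive.DenseModel

/-! ### The seminorm of a family of test functions -/

section family

variable {Z : Type*} [Fintype Z] {A : Type*}

/-- The inner product `⟨f, g⟩ = 𝔼_z f(z) g(z)` on functions `Z → ℝ` (uniform probability measure on
the finite set `Z`). [cite: Gowers2010, §4] -/
def inner (f g : Z → ℝ) : ℝ := 𝔼 z, f z * g z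

/-- **`‖h‖_Φ ≤ t`** for the seminorm `‖h‖_Φ = sup_{a} |⟨h, φ_a⟩|` attached to a family of test
functions `Φ = (φ_a)_{a ∈ A}`. [cite: Gowers2010, §4] -/
def SmallAgainst (φ : A → Z → ℝ) (h : Z → ℝ) (t : ℝ) : Prop :=
  ∀ a, |inner h (φ a)| ≤ t

/-- Additivity of `⟨·, u⟩`. [folklore] -/
theorem inner_add_left (f g u : Z → ℝ) : inner (f + g) u = inner f u + inner g u := by
  simp only [inner, Pi.add_apply, add_mul, expect_add_distrib]

/-- `⟨-f, u⟩ = -⟨f, u⟩`. [folklore] -/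
theorem inner_neg_left (f u : Z → ℝ) : inner (fun z => -f z) u = -inner f u := by
  simp only [inner, neg_mul, expect_neg_distrib]

/-- Homogeneity of `⟨·, u⟩`. [folklore] -/
theorem inner_const_mul_left (c : ℝ) (f u : Z → ℝ) :
    inner (fun z => c * f z) u = c * inner f u := by
  simp only [inner, mul_assoc, mul_expect]

/-- `⟨f - g, u⟩ = ⟨f, u⟩ - ⟨g, u⟩`. [folklore] -/
theorem inner_sub_left (f g u : Z → ℝ) :
    inner (fun z => f z - g z) u = inner f u - inner g u := by
  simp only [inner, sub_mul, expect_sub_distrib]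

/-- `‖·‖_Φ ≤ ‖·‖₁` when the test functions are bounded by `1`. [cite: Gowers2010, §4] -/
theorem abs_inner_le_expect_abs {φ : A → Z → ℝ} (hφ : ∀ a z, |φ a z| ≤ 1) (h : Z → ℝ) (a : A) :
    |inner h (φ a)| ≤ 𝔼 z, |h z| := by
  unfold inner
  refine (abs_expect_le _ _).trans (expect_le_expect fun z _ => ?_)
  rw [abs_mul]
  exact mul_le_of_le_one_right (abs_nonneg _) (hφ a z)

/-- A pointwise bound `|h| ≤ t` gives `‖h‖_Φ ≤ t`. [folklore] -/
theorem smallAgainst_of_abs_le [Nonempty Z] {φ : A → Z → ℝ} (hφ : ∀ a z, |φ a z| ≤ 1)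
    {h : Z → ℝ} {t : ℝ} (ht : ∀ z, |h z| ≤ t) : SmallAgainst φ h t := fun a =>
  (abs_inner_le_expect_abs hφ h a).trans
    ((expect_le_expect fun z _ => ht z).trans (expect_const univ_nonempty t).le)

/-- `‖h‖_Φ ≤ t` forces `0 ≤ t` (non-empty family). [folklore] -/
theorem SmallAgainst.nonneg [Nonempty A] {φ : A → Z → ℝ} {h : Z → ℝ} {t : ℝ}
    (hh : SmallAgainst φ h t) : 0 ≤ t :=
  (abs_nonneg _).trans (hh (Classical.arbitrary A))

/-- `‖-h‖_Φ = ‖h‖_Φ`. [folklore] -/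
theorem SmallAgainst.neg {φ : A → Z → ℝ} {h : Z → ℝ} {t : ℝ} (hh : SmallAgainst φ h t) :
    SmallAgainst φ (fun z => -h z) t := fun a => by
  rw [inner_neg_left, abs_neg]; exact hh a

/-- Homogeneity of `‖·‖_Φ`. [folklore] -/
theorem SmallAgainst.const_mul {φ : A → Z → ℝ} {h : Z → ℝ} {t : ℝ} (hh : SmallAgainst φ h t)
    (c : ℝ) : SmallAgainst φ (fun z => c * h z) (|c| * t) := fun a => by
  rw [inner_const_mul_left, abs_mul]
  exact mul_le_mul_of_nonneg_left (hh a) (abs_nonneg c)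

/-- The triangle inequality for `‖·‖_Φ`: sums. [folklore] -/
theorem SmallAgainst.add {φ : A → Z → ℝ} {h h' : Z → ℝ} {s t : ℝ} (hh : SmallAgainst φ h s)
    (hh' : SmallAgainst φ h' t) : SmallAgainst φ (fun z => h z + h' z) (s + t) := fun a => by
  rw [show (fun z => h z + h' z) = h + h' from rfl, inner_add_left]
  exact (abs_add_le _ _).trans (add_le_add (hh a) (hh' a))

/-- The triangle inequality for `‖·‖_Φ`: differences. [folklore] -/
theorem SmallAgainst.sub {φ : A → Z → ℝ} {h h' : Z → ℝ} {s t : ℝ} (hh : SmallAgainst φ h s)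
    (hh' : SmallAgainst φ h' t) : SmallAgainst φ (fun z => h z - h' z) (s + t) := fun a => by
  rw [inner_sub_left]
  exact (abs_sub _ _).trans (add_le_add (hh a) (hh' a))

/-- Monotonicity of `‖h‖_Φ ≤ t` in `t`. [folklore] -/
theorem SmallAgainst.mono {φ : A → Z → ℝ} {h : Z → ℝ} {s t : ℝ} (hh : SmallAgainst φ h s)
    (hst : s ≤ t) : SmallAgainst φ h t := fun a => (hh a).trans hst

end family

/-! ### The absolutely convex hull of the family and the dual norm -/

section ball

variable {Z : Type*} {A : Type*} [Fintype A]

/-- The absolutely convex hull `B = {∑_a c_a φ_a : ∑_a |c_a| ≤ 1}` of the family — the candidate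
unit ball of the dual norm `‖ψ‖_Φ^* = sup {|⟨h,ψ⟩| : ‖h‖_Φ ≤ 1}`.
[cite: Gowers2010, §4] -/
def ballGen (φ : A → Z → ℝ) : Set (Z → ℝ) :=
  (fun c : A → ℝ => ∑ a, c a • φ a) '' {c | ∑ a, |c a| ≤ 1}

/-- Elements of `B` pair with `h` to at most `‖h‖_Φ`. [cite: Gowers2010, §4] -/
theorem abs_inner_le_of_mem_ballGen [Fintype Z] {φ : A → Z → ℝ} {u h : Z → ℝ} (hu : u ∈ ballGen φ)
    {t : ℝ} (ht : SmallAgainst φ h t) (ht0 : 0 ≤ t) : |inner h u| ≤ t := by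
  obtain ⟨c, hc, rfl⟩ := hu
  have hlin : inner h (∑ a, c a • φ a) = ∑ a, c a * inner h (φ a) := by
    unfold inner
    calc (𝔼 z, h z * (∑ a, c a • φ a) z)
        = 𝔼 z, ∑ a, c a * (h z * φ a z) := by
          refine expect_congr rfl fun z _ => ?_
          rw [Finset.sum_apply, Finset.mul_sum]
          refine Finset.sum_congr rfl fun a _ => ?_
          rw [Pi.smul_apply, smul_eq_mul]; ring
      _ = ∑ a, 𝔼 z, c a * (h z * φ a z) := expect_sum_comm _ _ _
      _ = ∑ a, c a * 𝔼 z, h z * φ a z := by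
          refine Finset.sum_congr rfl fun a _ => ?_
          rw [mul_expect]
  rw [hlin]
  refine (abs_sum_le_sum_abs _ _).trans ?_
  have hb : ∀ a, |c a * inner h (φ a)| ≤ |c a| * t := fun a => by
    rw [abs_mul]
    exact mul_le_mul_of_nonneg_left (ht a) (abs_nonneg _)
  refine (sum_le_sum fun a _ => hb a).trans ?_
  rw [← sum_mul]
  exact mul_le_of_le_one_left ht0 hc

/-- `φ_a ∈ B`. [folklore] -/
theorem mem_ballGen [DecidableEq A] (φ : A → Z → ℝ) (a : A) : φ a ∈ ballGen φ := by
  refine ⟨fun b => if b = a then 1 else 0, ?_, ?_⟩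
  · show ∑ b, |(if b = a then (1 : ℝ) else 0)| ≤ 1
    simp only [apply_ite abs, abs_one, abs_zero, sum_ite_eq', mem_univ, if_true]
    rfl
  · simp

/-- `-B ⊆ B`. [folklore] -/
theorem neg_mem_ballGen {φ : A → Z → ℝ} {u : Z → ℝ} (hu : u ∈ ballGen φ) : -u ∈ ballGen φ := by
  obtain ⟨c, hc, rfl⟩ := hu
  refine ⟨fun a => -c a, by simpa using hc, ?_⟩
  simp [sum_neg_distrib, neg_smul]

/-- `0 ∈ B`. [folklore] -/
theorem zero_mem_ballGen (φ : A → Z → ℝ) : (0 : Z → ℝ) ∈ ballGen φ :=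
  ⟨0, by simp, by simp⟩

/-- `B` is convex. [folklore] -/
theorem convex_ballGen (φ : A → Z → ℝ) : Convex ℝ (ballGen φ) := by
  intro u hu v hv p q hp hq hpq
  obtain ⟨c, hc, rfl⟩ := hu
  obtain ⟨d, hd, rfl⟩ := hv
  have hc' : ∑ a, |c a| ≤ 1 := hc
  have hd' : ∑ a, |d a| ≤ 1 := hd
  refine ⟨fun a => p * c a + q * d a, ?_, ?_⟩
  · calc ∑ a, |p * c a + q * d a| ≤ ∑ a, (p * |c a| + q * |d a|) :=
          sum_le_sum fun a _ => (abs_add_le _ _).trans (by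
            rw [abs_mul, abs_mul, abs_of_nonneg hp, abs_of_nonneg hq])
      _ = p * ∑ a, |c a| + q * ∑ a, |d a| := by
          rw [sum_add_distrib, mul_sum, mul_sum]
      _ ≤ p * 1 + q * 1 := by gcongr
      _ = 1 := by rw [mul_one, mul_one, hpq]
  · simp only [add_smul, sum_add_distrib, mul_smul, ← smul_sum]

/-- `B` is compact (the image of the `ℓ¹` unit ball of a finite-dimensional space). [folklore] -/
theorem isCompact_ballGen (φ : A → Z → ℝ) : IsCompact (ballGen φ) := by
  refine IsCompact.image (Metric.isCompact_of_isClosed_isBounded ?_ ?_) ?_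
  · exact isClosed_le (continuous_finsetSum _ fun a _ => (continuous_apply a).abs)
      continuous_const
  · refine (Metric.isBounded_closedBall (x := (0 : A → ℝ)) (r := 1)).subset ?_
    intro c hc
    rw [Metric.mem_closedBall, dist_zero_right, pi_norm_le_iff_of_nonneg zero_le_one]
    intro a
    rw [Real.norm_eq_abs]
    exact (single_le_sum (fun b _ => abs_nonneg (c b)) (mem_univ a)).trans hc
  · exact continuous_finsetSum _ fun a _ => (continuous_apply a).smul continuous_const

/-- `B` is closed. [folklore] -/
theorem isClosed_ballGen (φ : A → Z → ℝ) : IsClosed (ballGen φ) :=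
  (isCompact_ballGen φ).isClosed

omit [Fintype A] in
/-- Continuous linear functionals on `ℝ^Z` are represented by `⟨h₀, ·⟩` (`Z ≠ ∅`). [folklore] -/
theorem exists_inner_eq [Fintype Z] [Nonempty Z] [DecidableEq Z] (L : StrongDual ℝ (Z → ℝ)) :
    ∃ h₀ : Z → ℝ, ∀ g, L g = inner h₀ g := by
  refine ⟨fun z => (Fintype.card Z : ℝ) * L (fun j => if z = j then 1 else 0), fun g => ?_⟩
  have hN : (Fintype.card Z : ℝ) ≠ 0 := Nat.cast_ne_zero.mpr Fintype.card_ne_zero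
  unfold inner
  rw [Fintype.expect_eq_sum_div_card]
  conv_lhs => rw [pi_eq_sum_univ g, map_sum]
  rw [eq_div_iff hN, sum_mul]
  refine sum_congr rfl fun z _ => ?_
  rw [map_smul, smul_eq_mul]
  ring

/-- **The unit ball of the dual norm is contained in `B`** (by the separating hyperplane theorem):
if `|⟨h, ψ⟩| ≤ M ‖h‖_Φ` for all `h` (in the form `‖h‖_Φ ≤ t ⇒ |⟨h,ψ⟩| ≤ M t`), then `ψ / M ∈ B`.
[cite: Gowers2010, §4 (Cor. 3.2, the duality between `‖·‖_Φ` and its dual)] -/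
theorem div_mem_ballGen_of_dual [Fintype Z] [Nonempty Z] [DecidableEq Z] [DecidableEq A] {φ : A → Z → ℝ}
    {ψ : Z → ℝ} {M : ℝ} (hM : 0 < M)
    (hψ : ∀ (h : Z → ℝ) (t : ℝ), 0 < t → SmallAgainst φ h t → |inner h ψ| ≤ M * t) :
    (fun z => ψ z / M) ∈ ballGen φ := by
  by_contra hnot
  obtain ⟨L, s, hLs, hsψ⟩ :=
    geometric_hahn_banach_closed_point (convex_ballGen φ) (isClosed_ballGen φ) hnot
  obtain ⟨h₀, hh₀⟩ := exists_inner_eq L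
  have hs : 0 < s := by simpa [hh₀, inner] using hLs 0 (zero_mem_ballGen φ)
  -- `‖h₀‖_Φ ≤ s`
  have hsmall : SmallAgainst φ h₀ s := by
    intro a
    rw [abs_le]
    constructor
    · have := hLs _ (neg_mem_ballGen (mem_ballGen φ a))
      rw [hh₀] at this
      unfold inner at this ⊢
      simp only [Pi.neg_apply, mul_neg, expect_neg_distrib] at this
      linarith
    · have := hLs _ (mem_ballGen φ a)
      rw [hh₀] at this
      exact this.le
  have h1 := hψ h₀ s hs hsmall
  have h2 : s < inner h₀ (fun z => ψ z / M) := by rw [← hh₀]; exact hsψ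
  have h3 : inner h₀ (fun z => ψ z / M) = inner h₀ ψ / M := by
    unfold inner
    rw [expect_div]
    exact expect_congr rfl fun z _ => by ring
  rw [h3, lt_div_iff₀ hM] at h2
  have h4 := (abs_le.mp h1).2
  linarith [mul_comm s M]

/-- **Pseudorandomness against products controls powers of elements of `M · B`**: if
`|⟨ν - 1, φ_{a_1} ⋯ φ_{a_m}⟩| ≤ ε'` for all `a : Fin m → A`, then `|⟨ν - 1, u^m⟩| ≤ ε'` for
`u ∈ B` (expand `(∑ c_a φ_a)^m` and use `∑ |c_a| ≤ 1`), hence `|⟨ν - 1, ψ^m⟩| ≤ M^m ε'` when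
`ψ / M ∈ B`. [cite: ReingoldEtAl2008, Thm. 1.1 (proof)] -/
theorem abs_inner_pow_le_of_mem_ballGen [Fintype Z] {φ : A → Z → ℝ} {ν : Z → ℝ} {ε' : ℝ} (hε' : 0 ≤ ε')
    {m : ℕ} (hν : ∀ a : Fin m → A, |inner (fun z => ν z - 1) (fun z => ∏ i, φ (a i) z)| ≤ ε')
    {u : Z → ℝ} (hu : u ∈ ballGen φ) : |inner (fun z => ν z - 1) (u ^ m)| ≤ ε' := by
  obtain ⟨c, hc, rfl⟩ := hu
  have hc' : ∑ a, |c a| ≤ 1 := hc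
  -- expand the power
  have hexp : ∀ z, ((∑ a, c a • φ a) ^ m) z = ∑ p : Fin m → A, (∏ i, c (p i)) * ∏ i, φ (p i) z := by
    intro z
    rw [Pi.pow_apply, Finset.sum_apply, Fintype.sum_pow]
    refine Finset.sum_congr rfl fun p _ => ?_
    rw [← prod_mul_distrib]
    refine Finset.prod_congr rfl fun i _ => ?_
    rw [Pi.smul_apply, smul_eq_mul]
  have hlin : inner (fun z => ν z - 1) ((∑ a, c a • φ a) ^ m) =
      ∑ p : Fin m → A, (∏ i, c (p i)) * inner (fun z => ν z - 1) (fun z => ∏ i, φ (p i) z) := by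
    unfold inner
    simp_rw [hexp, Finset.mul_sum]
    rw [expect_sum_comm]
    refine Finset.sum_congr rfl fun p _ => ?_
    rw [mul_expect]
    exact expect_congr rfl fun z _ => by ring
  rw [hlin]
  refine (abs_sum_le_sum_abs _ _).trans ?_
  calc ∑ p : Fin m → A, |(∏ i, c (p i)) * inner (fun z => ν z - 1) (fun z => ∏ i, φ (p i) z)|
      ≤ ∑ p : Fin m → A, (∏ i, |c (p i)|) * ε' := sum_le_sum fun p _ => by
        rw [abs_mul, Finset.abs_prod]
        exact mul_le_mul_of_nonneg_left (hν p) (prod_nonneg fun i _ => abs_nonneg _)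
    _ = (∑ a, |c a|) ^ m * ε' := by rw [← sum_mul, Fintype.sum_pow]
    _ ≤ 1 ^ m * ε' := by gcongr
    _ = ε' := by rw [one_pow, one_mul]

omit [Fintype A] in
/-- `‖·‖_∞ ≤ ‖·‖_Φ^*` (test the dual bound against `|Z| · 1_{x'}`, whose `‖·‖_Φ`-norm is at most
`1` because `|φ_a| ≤ 1`): `|ψ(x')| ≤ M`. [cite: ConlonFoxZhao2014, proof of Theorem 5.1] -/
theorem abs_le_of_dual [Fintype Z] [Nonempty Z] [DecidableEq Z] {φ : A → Z → ℝ} (hφ : ∀ a z, |φ a z| ≤ 1)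
    {ψ : Z → ℝ} {M : ℝ}
    (hψ : ∀ (h : Z → ℝ) (t : ℝ), 0 < t → SmallAgainst φ h t → |inner h ψ| ≤ M * t)
    (x' : Z) : |ψ x'| ≤ M := by
  have hN : (Fintype.card Z : ℝ) ≠ 0 := Nat.cast_ne_zero.mpr Fintype.card_ne_zero
  set h : Z → ℝ := fun z => if z = x' then (Fintype.card Z : ℝ) else 0 with hh
  have hsmall : SmallAgainst φ h 1 := by
    intro a
    refine (abs_inner_le_expect_abs hφ h a).trans ?_
    have : (𝔼 z : Z, |h z|) = 1 := by
      rw [Fintype.expect_eq_sum_div_card]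
      simp [hh, apply_ite abs, hN]
    rw [this]
  have h1 := hψ h 1 one_pos hsmall
  have h2 : inner h ψ = ψ x' := by
    unfold inner
    simp only [hh, ite_mul, zero_mul]
    rw [Fintype.expect_eq_sum_div_card, sum_ite_eq', if_pos (mem_univ _)]
    field_simp
  rw [h2, mul_one] at h1
  exact h1

end ball

/-! ### The separation argument -/

section separation

variable {Z : Type*} [Fintype Z] {A : Type*}

/-- Continuity of `h ↦ ⟨h, u⟩`. [folklore] -/
theorem continuous_inner_left (u : Z → ℝ) : Continuous fun h : Z → ℝ => inner h u := by
  unfold inner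
  simp only [Finset.expect_eq_sum_div_card]
  refine Continuous.div_const (continuous_finsetSum _ fun z _ => ?_) _
  exact (continuous_apply z).mul continuous_const

/-- The set `K₂ = {h : ‖h‖_Φ ≤ t}` is closed. [folklore] -/
theorem isClosed_setOf_smallAgainst (φ : A → Z → ℝ) (t : ℝ) :
    IsClosed {h : Z → ℝ | SmallAgainst φ h t} := by
  have : {h : Z → ℝ | SmallAgainst φ h t} = ⋂ a : A, {h | |inner h (φ a)| ≤ t} := by
    ext h
    simp only [Set.mem_setOf_eq, Set.mem_iInter, SmallAgainst]
  rw [this]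
  exact isClosed_iInter fun a => isClosed_le (continuous_inner_left (φ a)).abs continuous_const

/-- The set `K₂` is convex. [folklore] -/
theorem convex_setOf_smallAgainst (φ : A → Z → ℝ) (t : ℝ) :
    Convex ℝ {h : Z → ℝ | SmallAgainst φ h t} := by
  intro h₁ hh₁ h₂ hh₂ p q hp hq hpq a
  have h1 := hh₁ a
  have h2 := hh₂ a
  have : inner (p • h₁ + q • h₂) (φ a) = p * inner h₁ (φ a) + q * inner h₂ (φ a) := by
    rw [inner_add_left]
    simp only [inner, Pi.smul_apply, smul_eq_mul, mul_assoc, mul_expect]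
  rw [this]
  calc |p * inner h₁ (φ a) + q * inner h₂ (φ a)|
      ≤ p * t + q * t := (abs_add_le _ _).trans (by
        rw [abs_mul, abs_mul, abs_of_nonneg hp, abs_of_nonneg hq]
        exact add_le_add (mul_le_mul_of_nonneg_left h1 hp) (mul_le_mul_of_nonneg_left h2 hq))
    _ = t := by rw [← add_mul, hpq, one_mul]

variable [Nonempty Z] [DecidableEq Z]

/-- **The separating functional**: if no `g` with values in `[0, c]` has `‖f - g‖_Φ ≤ t`, then
(separating the compact convex set `f - [0,c]^Z` from the closed convex `{‖h‖_Φ ≤ t}` by the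
Hahn–Banach theorem and normalising) there is `ψ` with (a) `⟨f, ψ⟩ > 1` and (b) `⟨g + h, ψ⟩ < 1`
for all `g ∈ [0,c]^Z`, `‖h‖_Φ ≤ t`.
[cite: Gowers2010, §4] [cite: ConlonFoxZhao2014, proof of Theorem 5.1] -/
theorem exists_separating {φ : A → Z → ℝ} (hφ : ∀ a z, |φ a z| ≤ 1) (f : Z → ℝ) {c t : ℝ}
    (hc : 0 ≤ c) (ht : 0 ≤ t)
    (hcon : ∀ g : Z → ℝ, (∀ z, 0 ≤ g z) → (∀ z, g z ≤ c) →
      ¬ SmallAgainst φ (fun z => f z - g z) t) :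
    ∃ ψ : Z → ℝ, 1 < inner f ψ ∧
      ∀ g h : Z → ℝ, (∀ z, 0 ≤ g z ∧ g z ≤ c) → SmallAgainst φ h t → inner (g + h) ψ < 1 := by
  set K1 : Set (Z → ℝ) := {g | ∀ z, 0 ≤ g z ∧ g z ≤ c} with hK1
  set K2 : Set (Z → ℝ) := {h | SmallAgainst φ h t} with hK2
  set S : Set (Z → ℝ) := (fun g => f - g) '' K1 with hS
  have hK1c : IsCompact K1 := by
    have : K1 = Set.Icc (0 : Z → ℝ) (fun _ => c) := by
      ext g
      simp only [hK1, Set.mem_setOf_eq, Set.mem_Icc, Pi.le_def, Pi.zero_apply]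
      exact ⟨fun h => ⟨fun z => (h z).1, fun z => (h z).2⟩, fun h z => ⟨h.1 z, h.2 z⟩⟩
    rw [this]
    exact isCompact_Icc
  have hSc : IsCompact S := hK1c.image (continuous_const.sub continuous_id)
  have hSconv : Convex ℝ S := by
    rintro _ ⟨g₁, hg₁, rfl⟩ _ ⟨g₂, hg₂, rfl⟩ p q hp hq hpq
    refine ⟨p • g₁ + q • g₂, fun z => ⟨?_, ?_⟩, ?_⟩
    · simp only [Pi.add_apply, Pi.smul_apply, smul_eq_mul]
      nlinarith [(hg₁ z).1, (hg₂ z).1]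
    · simp only [Pi.add_apply, Pi.smul_apply, smul_eq_mul]
      nlinarith [(hg₁ z).2, (hg₂ z).2]
    · funext z
      simp only [Pi.add_apply, Pi.smul_apply, Pi.sub_apply, smul_eq_mul]
      have : p + q = 1 := hpq
      linear_combination (-(f z)) * this
  have hdisj : Disjoint S K2 := by
    rw [Set.disjoint_left]
    rintro _ ⟨g, hg, rfl⟩ hK
    exact hcon g (fun z => (hg z).1) (fun z => (hg z).2) hK
  obtain ⟨L, u, v, hLu, huv, hLv⟩ := geometric_hahn_banach_compact_closed hSconv hSc
    (convex_setOf_smallAgainst φ t) (isClosed_setOf_smallAgainst φ t) hdisj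
  obtain ⟨h₀, hh₀⟩ := exists_inner_eq L
  have h0K1 : (0 : Z → ℝ) ∈ K1 := fun z => ⟨le_rfl, hc⟩
  have h0K2 : (0 : Z → ℝ) ∈ K2 := by
    show SmallAgainst φ (0 : Z → ℝ) t
    exact smallAgainst_of_abs_le hφ fun z => by simp only [Pi.zero_apply, abs_zero]; exact ht
  have hLf : L f < u := hLu f ⟨0, h0K1, sub_zero f⟩
  have hL0 : v < 0 := by simpa using hLv 0 h0K2
  set θ : ℝ := (u - v) - L f with hθ
  have hθpos : 0 < θ := by rw [hθ]; linarith
  refine ⟨fun z => -h₀ z / θ, ?_, ?_⟩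
  · have hψL : inner f (fun z => -h₀ z / θ) = -L f / θ := by
      rw [hh₀]
      unfold inner
      rw [← expect_neg_distrib, expect_div]
      exact expect_congr rfl fun z _ => by ring
    rw [hψL, lt_div_iff₀ hθpos, hθ]; linarith
  · intro g h hg hh
    have h1 := hLu (f - g) ⟨g, hg, rfl⟩
    have h2 := hLv h hh
    have hψL : inner (g + h) (fun z => -h₀ z / θ) = -L (g + h) / θ := by
      rw [hh₀]
      unfold inner
      rw [← expect_neg_distrib, expect_div]
      exact expect_congr rfl fun z _ => by ring
    rw [hψL, div_lt_one hθpos, hθ, map_add]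
    rw [map_sub] at h1
    linarith

omit [Nonempty Z] [DecidableEq Z] in
/-- **The dual norm bound `‖ψ‖_Φ^* ≤ 1/t`** from property (b) of the separating functional.
[cite: ConlonFoxZhao2014, proof of Theorem 5.1] -/
theorem dual_bound_of_separating {φ : A → Z → ℝ} {ψ : Z → ℝ} {c t : ℝ} (hc : 0 ≤ c)
    (ht : 0 < t)
    (hb : ∀ g h : Z → ℝ, (∀ z, 0 ≤ g z ∧ g z ≤ c) → SmallAgainst φ h t → inner (g + h) ψ < 1)
    (h : Z → ℝ) (s : ℝ) (hs : 0 < s) (hsmall : SmallAgainst φ h s) :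
    |inner h ψ| ≤ t⁻¹ * s := by
  have key : ∀ h' : Z → ℝ, SmallAgainst φ h' s → inner h' ψ < t⁻¹ * s := by
    intro h' hsmall'
    have hmem : SmallAgainst φ (fun z => t / s * h' z) t := by
      refine (hsmall'.const_mul (t / s)).mono (le_of_eq ?_)
      rw [abs_of_pos (by positivity), div_mul_cancel₀ _ hs.ne']
    have h1 := hb 0 (fun z => t / s * h' z) (fun z => ⟨le_rfl, hc⟩) hmem
    rw [zero_add] at h1
    rw [inner_const_mul_left] at h1
    have h3 : 0 < t / s := by positivity
    calc inner h' ψ = (t / s * inner h' ψ) / (t / s) := by field_simp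
      _ < 1 / (t / s) := by gcongr
      _ = t⁻¹ * s := by field_simp
  rw [abs_le]
  constructor
  · have := key (fun z => -h z) hsmall.neg
    rw [inner_neg_left] at this
    linarith
  · exact (key h hsmall).le

/-- **The heart of the proof**: with `ε₀ ≤ 1/10`, `M = 2/ε₀`, a polynomial `P` with
`|P(x) - x₊| < ε₀/8` on `[-M, M]`, `R = ∑ |p_i| M^i`, `ε' ≤ ε₀/8`, `ε' R ≤ ε₀/8`: if
`|⟨ν - 1, ∏_{i < m} φ_{a_i}⟩| ≤ ε'` for all `m ≤ deg P` and `0 ≤ f ≤ ν`, some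
`g : Z → [0, 1 + ε₀/2]` has `‖f - g‖_Φ ≤ ε₀/2` (otherwise the separating `ψ` gives
`1 < ⟨f,ψ⟩ ≤ ⟨ν,ψ₊⟩ ≤ ⟨ν,Pψ⟩ + ‖ν‖₁ ε₀/8 ≤ (1+ε₀/2)⁻¹ + ε₀/8 + ε'R + (1+ε')ε₀/8 ≤ 1`).
[cite: Gowers2010, §4] [cite: ConlonFoxZhao2014, proof of Theorem 5.1] -/
theorem exists_predense_model [Fintype A] [DecidableEq A] {φ : A → Z → ℝ} (hφ : ∀ a z, |φ a z| ≤ 1)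
    {ε₀ ε' R : ℝ} {P : Polynomial ℝ}
    (hε₀ : 0 < ε₀) (hε₀1 : ε₀ ≤ 1 / 10)
    (hP : ∀ x ∈ Set.Icc (-(2 / ε₀)) (2 / ε₀), |P.eval x - max x 0| < ε₀ / 8)
    (hR : R = ∑ i ∈ range (P.natDegree + 1), |P.coeff i| * (2 / ε₀) ^ i)
    (hε'pos : 0 < ε') (hε'R : ε' * R ≤ ε₀ / 8) (hε'small : ε' ≤ ε₀ / 8)
    {ν f : Z → ℝ} (hν : ∀ z, 0 ≤ ν z)
    (hν1 : ∀ m ≤ P.natDegree, ∀ a : Fin m → A,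
      |inner (fun z => ν z - 1) (fun z => ∏ i, φ (a i) z)| ≤ ε')
    (hf0 : ∀ z, 0 ≤ f z) (hfν : ∀ z, f z ≤ ν z) :
    ∃ g : Z → ℝ, (∀ z, 0 ≤ g z) ∧ (∀ z, g z ≤ 1 + ε₀ / 2) ∧
      SmallAgainst φ (fun z => f z - g z) (ε₀ / 2) := by
  by_contra hcon
  push Not at hcon
  set M : ℝ := 2 / ε₀ with hMdef
  have hM : 0 < M := by positivity
  obtain ⟨ψ, ha, hb⟩ := exists_separating hφ f (by positivity : (0 : ℝ) ≤ 1 + ε₀ / 2)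
    (by positivity : (0 : ℝ) ≤ ε₀ / 2) hcon
  -- (b1) `(1 + ε₀/2) 𝔼 ψ₊ < 1`
  have hb1 : (1 + ε₀ / 2) * 𝔼 z, max (ψ z) 0 < 1 := by
    have hg : ∀ z, 0 ≤ (if 0 < ψ z then 1 + ε₀ / 2 else (0 : ℝ)) ∧
        (if 0 < ψ z then 1 + ε₀ / 2 else (0 : ℝ)) ≤ 1 + ε₀ / 2 := by
      intro z
      split_ifs
      · exact ⟨by positivity, le_rfl⟩
      · exact ⟨le_rfl, by positivity⟩
    have h0 : SmallAgainst φ (0 : Z → ℝ) (ε₀ / 2) :=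
      smallAgainst_of_abs_le hφ fun z => by simp only [Pi.zero_apply, abs_zero]; positivity
    have := hb (fun z => if 0 < ψ z then 1 + ε₀ / 2 else 0) 0 hg h0
    rw [add_zero] at this
    unfold inner at this
    rw [mul_expect]
    convert this using 2 with z
    show (1 + ε₀ / 2) * max (ψ z) 0 = (if 0 < ψ z then 1 + ε₀ / 2 else 0) * ψ z
    by_cases h : 0 < ψ z
    · rw [if_pos h, max_eq_left h.le]
    · rw [if_neg h, max_eq_right (not_lt.mp h)]; ring
  -- (b2) the dual norm bound `‖ψ‖* ≤ M`
  have hdual : ∀ (h : Z → ℝ) (s : ℝ), 0 < s → SmallAgainst φ h s → |inner h ψ| ≤ M * s := by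
    intro h s hs hsmall
    have := dual_bound_of_separating (by positivity : (0 : ℝ) ≤ 1 + ε₀ / 2)
      (by positivity : (0 : ℝ) < ε₀ / 2) hb h s hs hsmall
    rw [inv_div] at this
    rw [hMdef]
    exact this
  -- `‖ψ‖_∞ ≤ M` and the Weierstrass polynomial on the range of `ψ`
  have hψM : ∀ z, |ψ z| ≤ M := abs_le_of_dual hφ hdual
  have hPψ : ∀ z, |P.eval (ψ z) - max (ψ z) 0| < ε₀ / 8 := fun z =>
    hP (ψ z) (Set.mem_Icc.mpr (abs_le.mp (hψM z)))
  -- `ψ / M ∈ B`, hence `|⟨ν - 1, ψ^i⟩| ≤ M^i ε'` for `i ≤ deg P`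
  have hmem : (fun z => ψ z / M) ∈ ballGen φ := div_mem_ballGen_of_dual hM hdual
  have hpow : ∀ i ≤ P.natDegree, |inner (fun z => ν z - 1) (ψ ^ i)| ≤ M ^ i * ε' := by
    intro i hi
    have hb' := abs_inner_pow_le_of_mem_ballGen hε'pos.le (hν1 i hi)
      (Set.mem_of_eq_of_mem rfl hmem) (m := i)
    have heq : inner (fun z => ν z - 1) (ψ ^ i) =
        M ^ i * inner (fun z => ν z - 1) ((fun z => ψ z / M) ^ i) := by
      unfold inner
      rw [mul_expect]
      refine expect_congr rfl fun z _ => ?_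
      simp only [Pi.pow_apply, div_pow]
      field_simp
    rw [heq, abs_mul, abs_pow, abs_of_pos hM]
    exact mul_le_mul_of_nonneg_left hb' (by positivity)
  -- `|⟨ν - 1, Pψ⟩| ≤ ε' R`
  have hνP : |inner (fun z => ν z - 1) (fun z => P.eval (ψ z))| ≤ ε' * R := by
    have hexp : inner (fun z => ν z - 1) (fun z => P.eval (ψ z)) =
        ∑ i ∈ range (P.natDegree + 1), P.coeff i * inner (fun z => ν z - 1) (ψ ^ i) := by
      unfold inner
      have : ∀ z, (ν z - 1) * P.eval (ψ z) =
          ∑ i ∈ range (P.natDegree + 1), P.coeff i * ((ν z - 1) * (ψ ^ i) z) := by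
        intro z
        rw [Polynomial.eval_eq_sum_range, Finset.mul_sum]
        exact Finset.sum_congr rfl fun i _ => by simp only [Pi.pow_apply]; ring
      simp_rw [this]
      rw [expect_sum_comm]
      exact Finset.sum_congr rfl fun i _ => (mul_expect _ _ _).symm
    rw [hexp]
    refine (abs_sum_le_sum_abs _ _).trans ?_
    rw [hR, Finset.mul_sum]
    refine sum_le_sum fun i hi => ?_
    have hi' : i ≤ P.natDegree := Nat.lt_succ_iff.mp (Finset.mem_range.mp hi)
    rw [abs_mul]
    calc |P.coeff i| * |inner (fun z => ν z - 1) (ψ ^ i)| ≤ |P.coeff i| * (M ^ i * ε') :=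
          mul_le_mul_of_nonneg_left (hpow i hi') (abs_nonneg _)
      _ = ε' * (|P.coeff i| * M ^ i) := by ring
  -- `𝔼 ν ≤ 1 + ε'` (the case `m = 0`)
  have hEν : 𝔼 z, ν z ≤ 1 + ε' := by
    have h0 := hν1 0 (Nat.zero_le _) (Fin.elim0)
    unfold inner at h0
    simp only [univ_eq_empty, prod_empty, mul_one] at h0
    rw [expect_sub_distrib, expect_const univ_nonempty] at h0
    linarith [(abs_le.mp h0).2]
  -- the chain of inequalities
  have s1 : inner f ψ ≤ 𝔼 z, ν z * max (ψ z) 0 := by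
    unfold inner
    refine expect_le_expect fun z _ => ?_
    calc f z * ψ z ≤ f z * max (ψ z) 0 := mul_le_mul_of_nonneg_left (le_max_left _ _) (hf0 z)
      _ ≤ ν z * max (ψ z) 0 := mul_le_mul_of_nonneg_right (hfν z) (le_max_right _ _)
  have s2 : (𝔼 z, ν z * max (ψ z) 0) ≤ 𝔼 z, ν z * (P.eval (ψ z) + ε₀ / 8) :=
    expect_le_expect fun z _ => mul_le_mul_of_nonneg_left
      (by linarith [(abs_lt.mp (hPψ z)).1]) (hν z)
  have s3 : (𝔼 z, ν z * (P.eval (ψ z) + ε₀ / 8)) =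
      (𝔼 z, P.eval (ψ z)) + inner (fun z => ν z - 1) (fun z => P.eval (ψ z)) +
        ε₀ / 8 * 𝔼 z, ν z := by
    unfold inner
    rw [mul_expect, ← expect_add_distrib, ← expect_add_distrib]
    exact expect_congr rfl fun z _ => by ring
  have s4 : (𝔼 z, P.eval (ψ z)) ≤ (𝔼 z, max (ψ z) 0) + ε₀ / 8 := by
    calc (𝔼 z, P.eval (ψ z)) ≤ 𝔼 z, (max (ψ z) 0 + ε₀ / 8) :=
          expect_le_expect fun z _ => by linarith [(abs_lt.mp (hPψ z)).2]
      _ = (𝔼 z, max (ψ z) 0) + ε₀ / 8 := by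
          rw [expect_add_distrib, expect_const (univ_nonempty (α := Z))]
  have s5 := (abs_le.mp hνP).2
  have s6 : ε₀ / 8 * 𝔼 z, ν z ≤ ε₀ / 8 * (1 + ε') :=
    mul_le_mul_of_nonneg_left hEν (by positivity)
  have hfin := CFZ.dm_numeric hε₀ hε₀1 hε'pos.le hε'small hb1
  linarith only [ha, s1, s2, s3, s4, s5, s6, hfin, hε'R]

end separation

/-! ### The theorem -/

/-- **The dense model theorem** (Gowers; Reingold–Trevisan–Tulsiani–Vadhan), for a finite family
`Φ = (φ_a)_{a ∈ A}` of test functions bounded by `1` on a finite probability space `Z`: for every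
`ε > 0` there are `K ∈ ℕ` and `ε' > 0` — depending on `ε` only — such that whenever
`ν : Z → [0,∞)` satisfies `|𝔼 (ν - 1) ∏_{i<m} φ_{a_i}| ≤ ε'` for all `m ≤ K`, `a : [m] → A`
(`m = 0`: `|𝔼 ν - 1| ≤ ε'`), every `f : Z → [0,∞)` with `f ≤ ν` admits `g : Z → [0, 1]` with
`sup_a |𝔼 (f - g) φ_a| ≤ ε`. Proof: `exists_predense_model` with the Weierstrass polynomial of
`x ↦ x₊` on `[-2/ε₀, 2/ε₀]`, then cap the model at `1`.
[cite: Gowers2010, §4] [cite: ReingoldEtAl2008, Thm. 1.1] -/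
theorem denseModel (ε : ℝ) (hε : 0 < ε) :
    ∃ (K : ℕ) (ε' : ℝ), 0 < ε' ∧
      ∀ (Z : Type) [Fintype Z] [Nonempty Z] (A : Type) [Fintype A] (φ : A → Z → ℝ),
        (∀ a z, |φ a z| ≤ 1) →
        ∀ ν : Z → ℝ, (∀ z, 0 ≤ ν z) →
          (∀ m ≤ K, ∀ a : Fin m → A, |𝔼 z, (ν z - 1) * ∏ i, φ (a i) z| ≤ ε') →
          ∀ f : Z → ℝ, (∀ z, 0 ≤ f z) → (∀ z, f z ≤ ν z) →
            ∃ g : Z → ℝ, (∀ z, 0 ≤ g z) ∧ (∀ z, g z ≤ 1) ∧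
              ∀ a, |𝔼 z, (f z - g z) * φ a z| ≤ ε := by
  classical
  -- constants: `ε₀ = min ε 1/10`, the Weierstrass polynomial `P`, `R`, `ε'`, `K = deg P`
  set ε₀ : ℝ := min ε (1 / 10) with hε₀def
  have hε₀ : 0 < ε₀ := lt_min hε (by norm_num)
  have hε₀ε : ε₀ ≤ ε := min_le_left _ _
  have hε₀1 : ε₀ ≤ 1 / 10 := min_le_right _ _
  obtain ⟨P, hP⟩ := exists_polynomial_near_of_continuousOn (-(2 / ε₀)) (2 / ε₀)
    (fun t => max t 0) ((continuous_id.max continuous_const).continuousOn) (ε₀ / 8)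
    (by positivity)
  set R : ℝ := ∑ i ∈ range (P.natDegree + 1), |P.coeff i| * (2 / ε₀) ^ i with hRdef
  have hR : 0 ≤ R := sum_nonneg fun i _ => by positivity
  have hε'pos : 0 < ε₀ / (8 * (R + 1)) := by positivity
  have hε'R : ε₀ / (8 * (R + 1)) * R ≤ ε₀ / 8 := by
    rw [div_mul_eq_mul_div, div_le_div_iff₀ (by positivity) (by norm_num)]
    nlinarith
  have hε'small : ε₀ / (8 * (R + 1)) ≤ ε₀ / 8 := by
    rw [div_le_div_iff₀ (by positivity) (by norm_num)]
    nlinarith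
  refine ⟨P.natDegree, ε₀ / (8 * (R + 1)), hε'pos, ?_⟩
  intro Z _ _ A _ φ hφ ν hν hν1 f hf0 hfν
  classical
  obtain ⟨g, hg0, hg1, hsmall⟩ :=
    exists_predense_model hφ hε₀ hε₀1 hP hRdef hε'pos hε'R hε'small hν
      (fun m hm a => hν1 m hm a) hf0 hfν
  -- the dense model: cap `g` at `1`
  refine ⟨fun z => min (g z) 1, fun z => le_min (hg0 z) zero_le_one,
    fun z => min_le_right _ _, ?_⟩
  have hcap : SmallAgainst φ (fun z => g z - min (g z) 1) (ε₀ / 2) := by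
    refine smallAgainst_of_abs_le hφ fun z => ?_
    rw [abs_le]
    constructor
    · linarith [min_le_left (g z) 1]
    · rcases le_or_gt (g z) 1 with h | h
      · rw [min_eq_left h]; linarith
      · rw [min_eq_right h.le]; linarith [hg1 z]
  have hsum := (hsmall.add hcap).mono (by linarith : ε₀ / 2 + ε₀ / 2 ≤ ε)
  intro a
  have := hsum a
  unfold inner at this
  refine (le_of_eq ?_).trans this
  congr 1
  exact expect_congr rfl fun z _ => by ring

/-- **The dense model theorem for signed functions** (`|f| ≤ ν`; split `f = f⁺ - f⁻` with
`0 ≤ f^± ≤ ν` and subtract the two models, as in the footnote to Green–Tao 2010, Prop. 10.3):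
with the same `K, ε'` as in `denseModel` for `ε/2`, every `f` with `|f| ≤ ν` has a model
`g : Z → [-1, 1]` with `sup_a |𝔼 (f - g) φ_a| ≤ ε`; moreover `g = g₁ - g₂`, `f - g = F₁ - F₂` with
`0 ≤ gᵢ ≤ 1`, `-1 ≤ Fᵢ ≤ ν` — recorded as the bound `|f - g| ≤ ν + 1`.
[cite: GreenTao2010, Prop. 10.3 (footnote)] [cite: Gowers2010, §4] -/
theorem denseModel_abs (ε : ℝ) (hε : 0 < ε) :
    ∃ (K : ℕ) (ε' : ℝ), 0 < ε' ∧
      ∀ (Z : Type) [Fintype Z] [Nonempty Z] (A : Type) [Fintype A] (φ : A → Z → ℝ),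
        (∀ a z, |φ a z| ≤ 1) →
        ∀ ν : Z → ℝ, (∀ z, 0 ≤ ν z) →
          (∀ m ≤ K, ∀ a : Fin m → A, |𝔼 z, (ν z - 1) * ∏ i, φ (a i) z| ≤ ε') →
          ∀ f : Z → ℝ, (∀ z, |f z| ≤ ν z) →
            ∃ g : Z → ℝ, (∀ z, |g z| ≤ 1) ∧ (∀ z, |f z - g z| ≤ ν z + 1) ∧
              ∀ a, |𝔼 z, (f z - g z) * φ a z| ≤ ε := by
  obtain ⟨K, ε', hε', H⟩ := denseModel (ε / 2) (half_pos hε)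
  refine ⟨K, ε', hε', fun Z _ _ A _ φ hφ ν hν hν1 f hf => ?_⟩
  -- positive and negative parts
  have hp0 : ∀ z, 0 ≤ max (f z) 0 := fun z => le_max_right _ _
  have hpν : ∀ z, max (f z) 0 ≤ ν z := fun z => max_le ((le_abs_self _).trans (hf z)) (hν z)
  have hn0 : ∀ z, 0 ≤ max (-f z) 0 := fun z => le_max_right _ _
  have hnν : ∀ z, max (-f z) 0 ≤ ν z := fun z => max_le ((neg_le_abs _).trans (hf z)) (hν z)
  obtain ⟨g₁, hg₁0, hg₁1, hg₁⟩ := H Z A φ hφ ν hν hν1 (fun z => max (f z) 0) hp0 hpν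
  obtain ⟨g₂, hg₂0, hg₂1, hg₂⟩ := H Z A φ hφ ν hν hν1 (fun z => max (-f z) 0) hn0 hnν
  have hsplit : ∀ z, f z = max (f z) 0 - max (-f z) 0 := fun z => by
    rcases le_total 0 (f z) with h | h
    · rw [max_eq_left h, max_eq_right (by linarith)]; ring
    · rw [max_eq_right h, max_eq_left (by linarith)]; ring
  refine ⟨fun z => g₁ z - g₂ z, fun z => ?_, fun z => ?_, fun a => ?_⟩
  · rw [abs_le]; constructor <;> linarith [hg₁0 z, hg₁1 z, hg₂0 z, hg₂1 z]
  · rw [hsplit z, abs_le]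
    constructor <;> nlinarith [hg₁0 z, hg₁1 z, hg₂0 z, hg₂1 z, hp0 z, hpν z, hn0 z, hnν z]
  · have h1 := hg₁ a
    have h2 := hg₂ a
    have heq : (𝔼 z, (f z - (g₁ z - g₂ z)) * φ a z) =
        (𝔼 z, (max (f z) 0 - g₁ z) * φ a z) - 𝔼 z, (max (-f z) 0 - g₂ z) * φ a z := by
      rw [← expect_sub_distrib]
      refine expect_congr rfl fun z _ => ?_
      have hs := hsplit z
      linear_combination (φ a z) * hs
    rw [heq]
    calc |(𝔼 z, (max (f z) 0 - g₁ z) * φ a z) - 𝔼 z, (max (-f z) 0 - g₂ z) * φ a z|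
        ≤ |𝔼 z, (max (f z) 0 - g₁ z) * φ a z| + |𝔼 z, (max (-f z) 0 - g₂ z) * φ a z| :=
          abs_sub _ _
      _ ≤ ε / 2 + ε / 2 := add_le_add h1 h2
      _ = ε := by ring

end Literature.Combinatorics.Additive.DenseModel
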